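import Literature.Computability.AlgebraicComplexity.TensorSemiring
import Literature.Computability.AlgebraicComplexity.FlatteningRank
import Literature.Computability.AlgebraicComplexity.OuterProductRank
import Literature.Computability.AlgebraicComplexity.AsymptoticSpectrumProofs
import HarnessLib

/-!
# Tensors all of whose flattening ranks are `≥ 2` have a cube restricting to `⟨2⟩`

Topic `Literature/Computability/AlgebraicComplexity`. A linear-algebra lemma needed to apply
Strassen's duality `Q̃(a) = min_φ φ(a)` (Zuiddam 2018, Cor. 2.14, hypothesis "`a^k ≥ 2` for some
`k`") to the semiring `T(K)` of tensors (`TensorSemiring.lean`): for a 3-tensor `t` over a field,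

> if `ζ⁽¹⁾(t) ≥ 2`, `ζ⁽²⁾(t) ≥ 2` and `ζ⁽³⁾(t) ≥ 2` (flattening ranks), then `t^{⊗3} ≥ ⟨2⟩`,
> i.e. `2 ≤ [t]^3` in `T(K)` (`TensorClass.two_le_mk_pow_three`).

Proof. (i) If the first two flattening ranks are `≥ 2` then some slice `t(·,·,c)` or some sum of
two slices `t(·,·,c) + t(·,·,c')` is a matrix of rank `≥ 2` (a linear space of matrices of rank
`≤ 1` has a common column vector or a common row vector), so `t` restricts to the "identity matrix
placed in legs 1, 2", `I₁₂ = e₁⊗e₁⊗1 + e₂⊗e₂⊗1 ∈ K^{2×2×1}` (invert a non-singular `2×2` minor):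
`restrictsTo_idMatrix₁₂`. (ii) By symmetry `t ≥ I₁₃` and `t ≥ I₂₃`. (iii)
`I₁₂ ⊗ I₁₃ ⊗ I₂₃` is the `2×2` matrix multiplication tensor (CVZ 2023, Remark 1.7: "the tensor
product equals the matrix multiplication tensor"), which restricts to `⟨2⟩` (keep the diagonal
matrix units). Everything here is proved; rank conditions are phrased through `2×2` minors, so no
matrix-rank API is needed.

## References

* M. Christandl, P. Vrana, J. Zuiddam, JAMS 36 (2023), Remark 1.7 and Example 1.4. [ChristandlVranaZuiddam2023]
* J. Zuiddam, PhD thesis (2018), Cor. 2.14 (the hypothesis `∃ k, a^k ≥ 2`). [Zuiddam2018]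
-/

noncomputable section

open scoped BigOperators
open Module Submodule

namespace Literature.Computability.AlgebraicComplexity

universe u

variable {K : Type u} [Field K]

/-! ## Matrices with vanishing `2 × 2` minors -/

section Minors

variable {ι κ μ : Type*}

/-- A matrix all of whose `2×2` minors vanish is an outer product `x ⊗ y` (pivot on a non-zero
entry). [folklore] -/
theorem exists_eq_mul_of_minors_eq_zero (P : ι → κ → K)
    (h : ∀ a₁ a₂ b₁ b₂, P a₁ b₁ * P a₂ b₂ = P a₁ b₂ * P a₂ b₁) :
    ∃ (x : ι → K) (y : κ → K), ∀ a b, P a b = x a * y b := by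
  by_cases hP : ∀ a b, P a b = 0
  · exact ⟨0, 0, fun a b => by simp [hP a b]⟩
  push Not at hP
  obtain ⟨a₀, b₀, h0⟩ := hP
  refine ⟨fun a => P a b₀, fun b => P a₀ b / P a₀ b₀, fun a b => ?_⟩
  have := h a a₀ b b₀
  field_simp
  linear_combination this

/-- **A space of matrices of rank `≤ 1` has a common column or a common row vector**, in the
form needed here: if every slice `t(·,·,c)` and every sum of two slices has vanishing `2×2`
minors, then `t(a,b,c) = x(a) V(b,c)` for some `x, V`, or `t(a,b,c) = y(b) W(a,c)` for some
`y, W`. (Pivot `p = t a₀ b₀ c₀ ≠ 0`, `x = t(·,b₀,c₀)`, `y = t(a₀,·,c₀)`; every slice has all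
columns proportional to `x` or all rows proportional to `y`, and slices of the two kinds cannot
coexist.) [folklore] -/
theorem exists_factor_of_slice_minors_eq_zero (t : ι → κ → μ → K)
    (h₁ : ∀ c a₁ a₂ b₁ b₂, t a₁ b₁ c * t a₂ b₂ c = t a₁ b₂ c * t a₂ b₁ c)
    (h₂ : ∀ c c' a₁ a₂ b₁ b₂, (t a₁ b₁ c + t a₁ b₁ c') * (t a₂ b₂ c + t a₂ b₂ c') =
      (t a₁ b₂ c + t a₁ b₂ c') * (t a₂ b₁ c + t a₂ b₁ c')) :
    (∃ (x : ι → K) (V : κ → μ → K), ∀ a b c, t a b c = x a * V b c) ∨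
      (∃ (y : κ → K) (W : ι → μ → K), ∀ a b c, t a b c = y b * W a c) := by
  by_cases ht : ∀ a b c, t a b c = 0
  · exact Or.inl ⟨0, 0, fun a b c => by simp [ht a b c]⟩
  push Not at ht
  obtain ⟨a₀, b₀, c₀, hp⟩ := ht
  -- pivot slice: `p · t(a,b,c₀) = x(a) y(b)` with `p = t a₀ b₀ c₀`, `x a = t a b₀ c₀`, `y b = t a₀ b c₀`
  have hP0 : ∀ a b, t a b c₀ = (t a₀ b₀ c₀)⁻¹ * (t a b₀ c₀ * t a₀ b c₀) := by
    intro a b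
    rw [eq_inv_mul_iff_mul_eq₀ hp]
    linear_combination h₁ c₀ a a₀ b b₀
  -- Step 1: every slice has all columns proportional to `x` (case `A`) or all rows
  -- proportional to `y` (case `B`)
  have step1 : ∀ c, (∀ a₁ a₂ b, t a₁ b₀ c₀ * t a₂ b c = t a₂ b₀ c₀ * t a₁ b c) ∨
      (∀ a b₁ b₂, t a₀ b₁ c₀ * t a b₂ c = t a₀ b₂ c₀ * t a b₁ c) := by
    intro c
    by_contra hc
    rw [not_or] at hc
    obtain ⟨hcA, hcB⟩ := hc
    obtain ⟨u, v, huv⟩ := exists_eq_mul_of_minors_eq_zero (fun a b => t a b c) (h₁ c)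
    simp only [not_forall] at hcA hcB
    obtain ⟨a₁, a₂, b, hne₁⟩ := hcA
    obtain ⟨a, b₁, b₂, hne₂⟩ := hcB
    rw [huv, huv] at hne₁ hne₂
    have hE₁ : t a₁ b₀ c₀ * u a₂ - t a₂ b₀ c₀ * u a₁ ≠ 0 := by
      intro h0; apply hne₁; linear_combination v b * h0
    have hE₂ : v b₁ * t a₀ b₂ c₀ - v b₂ * t a₀ b₁ c₀ ≠ 0 := by
      intro h0; apply hne₂; linear_combination (-u a) * h0
    -- the minor of `t(·,·,c₀) + t(·,·,c)` at `(a₁,a₂;b₁,b₂)` vanishes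
    have key := h₂ c₀ c a₁ a₂ b₁ b₂
    rw [hP0 a₁ b₁, hP0 a₂ b₂, hP0 a₁ b₂, hP0 a₂ b₁, huv a₁ b₁, huv a₂ b₂, huv a₁ b₂,
      huv a₂ b₁] at key
    have hzero : ((t a₀ b₀ c₀)⁻¹ * t a₁ b₀ c₀ * u a₂ - (t a₀ b₀ c₀)⁻¹ * t a₂ b₀ c₀ * u a₁) *
        (v b₁ * t a₀ b₂ c₀ - v b₂ * t a₀ b₁ c₀) = 0 := by
      linear_combination (-1 : K) * key
    rcases mul_eq_zero.1 hzero with h0 | h0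
    · apply hE₁
      have : (t a₀ b₀ c₀)⁻¹ * (t a₁ b₀ c₀ * u a₂ - t a₂ b₀ c₀ * u a₁) = 0 := by
        linear_combination h0
      exact (mul_eq_zero.1 this).resolve_left (inv_ne_zero hp)
    · exact hE₂ h0
  -- Step 2/3: all slices of kind `A` give the first form, all of kind `B` the second
  by_cases hallA : ∀ c a₁ a₂ b, t a₁ b₀ c₀ * t a₂ b c = t a₂ b₀ c₀ * t a₁ b c
  · refine Or.inl ⟨fun a => t a b₀ c₀, fun b c => t a₀ b c / t a₀ b₀ c₀, fun a b c => ?_⟩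
    rw [mul_div_assoc', eq_div_iff hp]
    linear_combination (-1 : K) * hallA c a a₀ b
  by_cases hallB : ∀ c a b₁ b₂, t a₀ b₁ c₀ * t a b₂ c = t a₀ b₂ c₀ * t a b₁ c
  · refine Or.inr ⟨fun b => t a₀ b c₀, fun a c => t a b₀ c / t a₀ b₀ c₀, fun a b c => ?_⟩
    rw [mul_div_assoc', eq_div_iff hp]
    linear_combination (-1 : K) * hallB c a b b₀
  -- Step 4: a slice of kind `A` not `B` plus a slice of kind `B` not `A` has a non-zero minor
  exfalso
  push Not at hallA hallB
  obtain ⟨c₂, a₁, a₂, b, hne₁⟩ := hallA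
  obtain ⟨c₁, a, b₁, b₂, hne₂⟩ := hallB
  have hc₁A : ∀ a₁ a₂ b, t a₁ b₀ c₀ * t a₂ b c₁ = t a₂ b₀ c₀ * t a₁ b c₁ :=
    (step1 c₁).resolve_right fun hB => hne₂ (hB a b₁ b₂)
  have hc₂B : ∀ a b₁ b₂, t a₀ b₁ c₀ * t a b₂ c₂ = t a₀ b₂ c₀ * t a b₁ c₂ :=
    (step1 c₂).resolve_left fun hA => hne₁ (hA a₁ a₂ b)
  -- `t(·,·,c₁) = x ⊗ v₁`, `t(·,·,c₂) = u₂ ⊗ y`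
  have hQ₁ : ∀ a b, t a b c₁ = t a b₀ c₀ * (t a₀ b c₁ / t a₀ b₀ c₀) := by
    intro a b
    rw [mul_div_assoc', eq_div_iff hp]
    linear_combination (-1 : K) * hc₁A a a₀ b
  have hQ₂ : ∀ a b, t a b c₂ = (t a b₀ c₂ / t a₀ b₀ c₀) * t a₀ b c₀ := by
    intro a b
    rw [div_mul_eq_mul_div, eq_div_iff hp]
    linear_combination (-1 : K) * hc₂B a b b₀
  rw [hQ₁ a b₂, hQ₁ a b₁] at hne₂
  rw [hQ₂ a₂ b, hQ₂ a₁ b] at hne₁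
  have hE₁ : t a₁ b₀ c₀ * (t a₂ b₀ c₂ / t a₀ b₀ c₀) - t a₂ b₀ c₀ * (t a₁ b₀ c₂ / t a₀ b₀ c₀) ≠ 0 := by
    intro h0; apply hne₁; linear_combination t a₀ b c₀ * h0
  have hE₂ : (t a₀ b₁ c₁ / t a₀ b₀ c₀) * t a₀ b₂ c₀ - (t a₀ b₂ c₁ / t a₀ b₀ c₀) * t a₀ b₁ c₀ ≠ 0 := by
    intro h0; apply hne₂; linear_combination (-t a b₀ c₀) * h0
  have key := h₂ c₁ c₂ a₁ a₂ b₁ b₂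
  rw [hQ₁ a₁ b₁, hQ₁ a₂ b₂, hQ₁ a₁ b₂, hQ₁ a₂ b₁, hQ₂ a₁ b₁, hQ₂ a₂ b₂, hQ₂ a₁ b₂,
    hQ₂ a₂ b₁] at key
  have hzero : (t a₁ b₀ c₀ * (t a₂ b₀ c₂ / t a₀ b₀ c₀) - t a₂ b₀ c₀ * (t a₁ b₀ c₂ / t a₀ b₀ c₀)) *
      ((t a₀ b₁ c₁ / t a₀ b₀ c₀) * t a₀ b₂ c₀ - (t a₀ b₂ c₁ / t a₀ b₀ c₀) * t a₀ b₁ c₀) = 0 := by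
    linear_combination key
  rcases mul_eq_zero.1 hzero with h0 | h0
  · exact hE₁ h0
  · exact hE₂ h0

/-- If `t(a,b,c) = x(a) V(b,c)` then `ζ⁽¹⁾(t) ≤ 1`. [folklore] -/
theorem flatteningRank_le_one_of_eq_mul {t : ι → κ → μ → K} {x : ι → K} {V : κ → μ → K}
    (h : ∀ a b c, t a b c = x a * V b c) : flatteningRank t ≤ 1 := by
  classical
  unfold flatteningRank
  set v : κ × μ → K := fun p => V p.1 p.2 with hv
  have hle : span K (Set.range (xSlices t)) ≤ span K (({v} : Finset (κ × μ → K)) : Set _) := by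
    rw [Submodule.span_le]
    rintro _ ⟨a, rfl⟩
    have : xSlices t a = x a • v := by
      funext p; simp [xSlices_apply, h, hv]
    rw [this]
    exact Submodule.smul_mem _ _ (subset_span (by simp))
  calc finrank K (span K (Set.range (xSlices t)))
      ≤ finrank K (span K (({v} : Finset (κ × μ → K)) : Set _)) := Submodule.finrank_mono hle
    _ ≤ ({v} : Finset (κ × μ → K)).card := finrank_span_le_card _
    _ = 1 := Finset.card_singleton v

/-- If `t(a,b,c) = y(b) W(a,c)` then `ζ⁽²⁾(t) ≤ 1` (flattening rank of the `(1 2)`-swapped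
tensor). [folklore] -/
theorem flatteningRank_swap_le_one_of_eq_mul {t : ι → κ → μ → K} {y : κ → K} {W : ι → μ → K}
    (h : ∀ a b c, t a b c = y b * W a c) : flatteningRank (fun b a c => t a b c) ≤ 1 :=
  flatteningRank_le_one_of_eq_mul (t := fun b a c => t a b c) (x := y) (V := W)
    fun b a c => h a b c

end Minors

/-! ## Restriction to the identity matrix `I₁₂` placed in two legs -/

section IdMatrix

variable {ι κ μ : Type*} [Fintype ι] [Fintype κ] [Fintype μ]

/-- **A non-singular `2×2` minor of a linear combination of slices gives `t ≥ I₁₂`**: if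
`M = Σ_c w_c t(·,·,c)` has `M a₁ b₁ M a₂ b₂ ≠ M a₁ b₂ M a₂ b₁`, then `t` restricts to the
`2×2×1` tensor `(i, j, *) ↦ [i = j]` (rows `a₁, a₂` through the inverse of the minor, columns
`b₁, b₂`, third leg `w`). [folklore] -/
theorem restrictsTo_idMatrix₁₂_of_minor_ne_zero (t : ι → κ → μ → K) (w : μ → K) (a₁ a₂ : ι)
    (b₁ b₂ : κ)
    (hD : (∑ c, w c * t a₁ b₁ c) * (∑ c, w c * t a₂ b₂ c) ≠
      (∑ c, w c * t a₁ b₂ c) * (∑ c, w c * t a₂ b₁ c)) :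
    TensorRestrictsTo t (fun (i j : Fin 2) (_ : Fin 1) => if i = j then (1 : K) else 0) := by
  classical
  set M : ι → κ → K := fun a b => ∑ c, w c * t a b c with hM
  have hD0 : M a₁ b₁ * M a₂ b₂ - M a₁ b₂ * M a₂ b₁ ≠ 0 := sub_ne_zero.2 hD
  -- inverse of the minor `N = [[M a₁ b₁, M a₁ b₂], [M a₂ b₁, M a₂ b₂]]`
  set Ninv : Fin 2 → Fin 2 → K := fun i i' =>
    (M a₁ b₁ * M a₂ b₂ - M a₁ b₂ * M a₂ b₁)⁻¹ *
      (if i = 0 then (if i' = 0 then M a₂ b₂ else -M a₁ b₂)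
        else (if i' = 0 then -M a₂ b₁ else M a₁ b₁)) with hNinv
  set av : Fin 2 → ι := fun i => if i = 0 then a₁ else a₂ with hav
  set bv : Fin 2 → κ := fun j => if j = 0 then b₁ else b₂ with hbv
  refine ⟨fun i a => ∑ i' : Fin 2, Ninv i i' * (if a = av i' then 1 else 0),
    fun j b => if b = bv j then 1 else 0, fun _ c => w c, fun i j z => ?_⟩
  -- evaluate the triple sum: `Σ_{i'} Ninv i i' M (av i') (bv j)`
  have inner : ∀ a, (∑ b, ∑ c, (∑ i' : Fin 2, Ninv i i' * (if a = av i' then 1 else 0)) *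
      (if b = bv j then 1 else 0) * w c * t a b c) =
      (∑ i' : Fin 2, Ninv i i' * (if a = av i' then 1 else 0)) * M a (bv j) := by
    intro a
    rw [Finset.sum_eq_single (bv j) (fun b _ hb => by simp [hb]) (by simp)]
    simp only [if_true, mul_one, hM, Finset.mul_sum]
    exact Finset.sum_congr rfl fun c _ => by ring
  have hsum : (∑ a, ∑ b, ∑ c, (∑ i' : Fin 2, Ninv i i' * (if a = av i' then 1 else 0)) *
      (if b = bv j then 1 else 0) * w c * t a b c) = ∑ i' : Fin 2, Ninv i i' * M (av i') (bv j) := by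
    simp_rw [inner]
    rw [show (∑ a, (∑ i' : Fin 2, Ninv i i' * (if a = av i' then 1 else 0)) * M a (bv j)) =
      ∑ i' : Fin 2, Ninv i i' * ∑ a, (if a = av i' then 1 else 0) * M a (bv j) by
        simp only [Finset.sum_mul, Finset.mul_sum]
        rw [Finset.sum_comm]
        exact Finset.sum_congr rfl fun i' _ => Finset.sum_congr rfl fun a _ => by ring]
    refine Finset.sum_congr rfl fun i' _ => ?_
    rw [Finset.sum_eq_single (av i') (fun a _ ha => by simp [ha]) (by simp)]
    simp
  rw [hsum, Fin.sum_univ_two]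
  -- the four entries of `N⁻¹ N`
  fin_cases i <;> fin_cases j <;> simp [hNinv, hav, hbv] <;> field_simp <;> ring

end IdMatrix

/-! ## From flattening ranks to `I₁₂` -/

section Flattening

variable {ι κ μ : Type*} [Fintype ι] [Fintype κ] [Fintype μ]

/-- **`ζ⁽¹⁾(t) ≥ 2` and `ζ⁽²⁾(t) ≥ 2` imply `t ≥ I₁₂`**: some slice or sum of two slices along the
third leg is a matrix of rank `≥ 2`. [folklore] -/
theorem restrictsTo_idMatrix₁₂ (t : ι → κ → μ → K) (h₁ : 2 ≤ flatteningRank t)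
    (h₂ : 2 ≤ flatteningRank (fun b a c => t a b c)) :
    TensorRestrictsTo t (fun (i j : Fin 2) (_ : Fin 1) => if i = j then (1 : K) else 0) := by
  classical
  -- either some candidate minor is non-zero, or the factor lemma contradicts the ranks
  by_cases hex : ∃ (w : μ → K) (a₁ a₂ : ι) (b₁ b₂ : κ),
      (∑ c, w c * t a₁ b₁ c) * (∑ c, w c * t a₂ b₂ c) ≠
        (∑ c, w c * t a₁ b₂ c) * (∑ c, w c * t a₂ b₁ c)
  · obtain ⟨w, a₁, a₂, b₁, b₂, hD⟩ := hex
    exact restrictsTo_idMatrix₁₂_of_minor_ne_zero t w a₁ a₂ b₁ b₂ hD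
  exfalso
  push Not at hex
  have hsingle : ∀ c a b, (∑ c', (if c' = c then (1 : K) else 0) * t a b c') = t a b c := by
    intro c a b
    rw [Finset.sum_eq_single c (fun c' _ hc' => by simp [hc']) (by simp)]
    simp
  have hpair : ∀ c₁ c₂ a b, c₁ ≠ c₂ →
      (∑ c', ((if c' = c₁ then (1 : K) else 0) + (if c' = c₂ then 1 else 0)) * t a b c') =
        t a b c₁ + t a b c₂ := by
    intro c₁ c₂ a b hne
    simp only [add_mul, Finset.sum_add_distrib, hsingle]
  have H₁ : ∀ c a₁ a₂ b₁ b₂, t a₁ b₁ c * t a₂ b₂ c = t a₁ b₂ c * t a₂ b₁ c := by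
    intro c a₁ a₂ b₁ b₂
    have := hex (fun c' => if c' = c then 1 else 0) a₁ a₂ b₁ b₂
    simpa only [hsingle] using this
  have H₂ : ∀ c c' a₁ a₂ b₁ b₂, (t a₁ b₁ c + t a₁ b₁ c') * (t a₂ b₂ c + t a₂ b₂ c') =
      (t a₁ b₂ c + t a₁ b₂ c') * (t a₂ b₁ c + t a₂ b₁ c') := by
    intro c c' a₁ a₂ b₁ b₂
    by_cases hcc : c = c'
    · subst hcc
      have := H₁ c a₁ a₂ b₁ b₂
      linear_combination (4 : K) * this
    have := hex (fun d => (if d = c then 1 else 0) + (if d = c' then 1 else 0)) a₁ a₂ b₁ b₂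
    simpa only [hpair c c' _ _ hcc] using this
  rcases exists_factor_of_slice_minors_eq_zero t H₁ H₂ with ⟨x, V, hxV⟩ | ⟨y, W, hyW⟩
  · have := flatteningRank_le_one_of_eq_mul hxV
    omega
  · have := flatteningRank_swap_le_one_of_eq_mul hyW
    omega

end Flattening

/-! ## The cube restricts to `⟨2⟩` -/

section Cube

variable {ι κ μ ι' κ' μ' : Type*}

omit [Field K] in
/-- Restriction is compatible with swapping the last two legs. [folklore] -/
theorem TensorRestrictsTo.swap₂₃ {K : Type u} [CommSemiring K] [Fintype ι] [Fintype κ]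
    [Fintype μ] {t : ι → κ → μ → K} {s : ι' → κ' → μ' → K} (h : TensorRestrictsTo t s) :
    TensorRestrictsTo (fun a c b => t a b c) (fun a c b => s a b c) := by
  obtain ⟨A, B, C, h⟩ := h
  refine ⟨A, C, B, fun a' c' b' => ?_⟩
  dsimp only
  rw [h a' b' c']
  refine Finset.sum_congr rfl fun a _ => ?_
  rw [Finset.sum_comm]
  exact Finset.sum_congr rfl fun c _ => Finset.sum_congr rfl fun b _ => by ring

/-- **`I₁₂ ⊗ I₁₃ ⊗ I₂₃ ≥ ⟨2⟩`**: the product of the three placed identity matrices is the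
`2×2` matrix multiplication tensor (CVZ 2023, Remark 1.7), and its diagonal part is `⟨2⟩`.
[cite: ChristandlVranaZuiddam2023, Remark 1.7] -/
theorem restrictsTo_unitTensor_two_idMatrix_cube :
    TensorRestrictsTo
      (kroneckerTensor
        (kroneckerTensor (fun (i j : Fin 2) (_ : Fin 1) => if i = j then (1 : K) else 0)
          (fun (i : Fin 2) (_ : Fin 1) (l : Fin 2) => if i = l then (1 : K) else 0))
        (fun (_ : Fin 1) (j l : Fin 2) => if j = l then (1 : K) else 0))
      (unitTensor K 2) := by
  classical
  have e : unitTensor K 2 = fun i j l =>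
      (kroneckerTensor
        (kroneckerTensor (fun (i j : Fin 2) (_ : Fin 1) => if i = j then (1 : K) else 0)
          (fun (i : Fin 2) (_ : Fin 1) (l : Fin 2) => if i = l then (1 : K) else 0))
        (fun (_ : Fin 1) (j l : Fin 2) => if j = l then (1 : K) else 0))
      ((i, i), 0) ((j, 0), j) ((0, l), l) := by
    funext i j l
    simp only [unitTensor_apply, kroneckerTensor_apply]
    fin_cases i <;> fin_cases j <;> fin_cases l <;> simp
  rw [e]
  exact tensorRestrictsTo_precomp _ _ _ _

/-- The flattening rank along the first leg is unchanged by swapping the other two legs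
(slices are transposed). [folklore] -/
theorem flatteningRank_swap₂₃ (s : ι → κ → μ → K) :
    flatteningRank (fun a c b => s a b c) = flatteningRank s := by
  unfold flatteningRank
  set L : (κ × μ → K) ≃ₗ[K] (μ × κ → K) :=
    LinearEquiv.funCongrLeft K K (Equiv.prodComm μ κ) with hL
  have key : xSlices (fun a c b => s a b c) = L ∘ xSlices s := by
    funext a q; rfl
  rw [key, OuterProductRank.finrank_span_range_comp_linearEquiv]

/-- **If all three flattening ranks of `t` are `≥ 2` then `2 ≤ [t]^3` in `T(K)`** (i.e.
`t^{⊗3} ≥ ⟨2⟩`): `t ≥ I₁₂, I₁₃, I₂₃` by `restrictsTo_idMatrix₁₂` applied to `t` and its leg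
permutations, and `I₁₂ ⊗ I₁₃ ⊗ I₂₃ ≥ ⟨2⟩`. This supplies the hypothesis "`a^k ≥ 2` for some `k`"
of Zuiddam 2018, Cor. 2.14 for such tensors. [cite: Zuiddam2018, Cor. 2.14] -/
theorem TensorClass.two_le_mk_pow_three {ι κ μ : Type*} [Fintype ι] [Fintype κ] [Fintype μ]
    (t : ι → κ → μ → K) (h₁ : 2 ≤ flatteningRank t)
    (h₂ : 2 ≤ flatteningRank (fun b a c => t a b c))
    (h₃ : 2 ≤ flatteningRank (fun c a b => t a b c)) :
    (2 : TensorClass K) ≤ TensorClass.mk t ^ 3 := by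
  classical
  have e₁ : flatteningRank (fun a c b => t a b c) = flatteningRank t := flatteningRank_swap₂₃ t
  have e₂ := flatteningRank_swap₂₃ (fun b a c => t a b c)
  have e₃ := flatteningRank_swap₂₃ (fun c a b => t a b c)
  -- `t ≥ I₁₂`
  have r₁₂ : TensorRestrictsTo t (fun (i j : Fin 2) (_ : Fin 1) => if i = j then (1 : K) else 0) :=
    restrictsTo_idMatrix₁₂ t h₁ h₂
  -- `t ≥ I₁₃` via the `(2 3)`-swapped tensor `(a, c, b) ↦ t a b c`
  have r₁₃ : TensorRestrictsTo t
      (fun (i : Fin 2) (_ : Fin 1) (l : Fin 2) => if i = l then (1 : K) else 0) :=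
    (restrictsTo_idMatrix₁₂ (fun a c b => t a b c) (by rw [e₁]; exact h₁) h₃).swap₂₃
  -- `t ≥ I₂₃` via the cyclically permuted tensor `(b, c, a) ↦ t a b c`
  have r₂₃ : TensorRestrictsTo t
      (fun (_ : Fin 1) (j l : Fin 2) => if j = l then (1 : K) else 0) :=
    (restrictsTo_idMatrix₁₂ (fun b c a => t a b c) (by rw [e₂]; exact h₂)
      (by rw [e₃]; exact h₃)).swap₁₃
  -- multiply the three restrictions in `T(K)`
  have e3 : TensorClass.mk t ^ 3 = TensorClass.mk t * TensorClass.mk t * TensorClass.mk t := by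
    rw [pow_succ, pow_two]
  rw [e3, TensorClass.mk_mul_mk, TensorClass.mk_mul_mk,
    show (2 : TensorClass K) = TensorClass.mk (unitTensor K 2) from TensorClass.natCast_eq_mk 2,
    TensorClass.mk_le_mk_iff]
  exact ((r₁₂.kronecker r₁₃).kronecker r₂₃).trans restrictsTo_unitTensor_two_idMatrix_cube

end Cube

end Literature.Computability.AlgebraicComplexity

end
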